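import Mathlib.MeasureTheory.Integral.Bochner.Basic
import Mathlib.MeasureTheory.Measure.Dirac
import Mathlib.MeasureTheory.Measure.WithDensity
import Mathlib.MeasureTheory.Integral.IntegralEqImproper
import Mathlib.Analysis.SpecialFunctions.ImproperIntegrals
import Mathlib.Analysis.SpecialFunctions.Pow.Real
import Mathlib.Analysis.SpecialFunctions.Integrals.Basic
import HarnessLib

/-!
# Stieltjes functions

A function `f : (0, ∞) → [0, ∞)` is a (non-negative) **Stieltjes function** if it admits the
representation
$$ f(s) = \frac{a}{s} + b + \int_{(0,\infty)} \frac{\sigma(dt)}{s + t}, \qquad s > 0, $$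
with constants `a, b ≥ 0` and a (positive) measure `σ` on `(0, ∞)` such that
`∫_{(0,∞)} (1 + t)⁻¹ σ(dt) < ∞` [cite: SchillingSongVondracek2012, Def. 2.1];
equivalently (mass of `σ` at `0` producing the term `a/s`) `f(s) = b + ∫_{[0,∞)} σ(dt)/(s+t)`
[cite: BergChristensenRessel1984, Ch. 4, Notes and Remarks, p. 141], i.e. `f` is a non-negative
constant plus the *Stieltjes transform* of a non-decreasing function
[cite: Widder1941, Ch. VIII §1 (2) and Thm 18b].

## Main definitions and results

* `IsStieltjesFunction f` : the predicate above for `f : ℝ → ℝ` (values of `f` on `(-∞, 0]` are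
  irrelevant); the representing measure is a `Measure ℝ` carried by `(0, ∞)`.
* closure under addition and multiplication by non-negative constants
  (`IsStieltjesFunction.add`, `IsStieltjesFunction.smul`), the examples `s ↦ b`, `s ↦ 1/s`,
  `s ↦ (s + m)⁻¹` (`m ≥ 0`) and `s ↦ s ^ (-α)` (`0 < α ≤ 1`)
  [cite: BergChristensenRessel1984, p. 141];
* elementary consequences of the representation: `f ≥ 0` and `f` is non-increasing on `(0, ∞)`.

## Not here

The deep characterisations — Stieltjes functions are exactly the functions `f ≥ 0` on `(0,∞)`
with `(-1)^{k-1} (x^k f)^{(2k-1)} ≥ 0` for all `k ≥ 1` [cite: Widder1941, Ch. VIII Thm 18b];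
exactly the iterated Laplace transforms `a/s + b + 𝓛(g)` with `g` completely monotone; exactly
the functions positive on `(0,∞)` with a holomorphic extension to `ℂ \ (-∞,0]` satisfying
`Im z · Im f(z) ≤ 0` (Nevanlinna–Pick form) [cite: SchillingSongVondracek2012, Ch. 2, 6, 7] —
are not formalised in this file.
-/

noncomputable section

namespace Literature.Analysis.SpecialFunctions

open _root_.MeasureTheory _root_.Set _root_.Filter
open scoped ENNReal NNReal

/-- `f : ℝ → ℝ` **is a (non-negative) Stieltjes function**: there are constants `a, b ≥ 0` and a
measure `σ` on `ℝ` carried by `(0, ∞)` (i.e. `σ (-∞, 0] = 0`) with `∫ (1 + t)⁻¹ dσ(t) < ∞` such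
that `f s = a / s + b + ∫ (s + t)⁻¹ dσ(t)` for every `s > 0`. The values of `f` on `(-∞, 0]`
are not constrained. [cite: SchillingSongVondracek2012, Def. 2.1]
(same class as `b + ∫_{[0,∞)} dμ(x)/(s+x)`, `μ ∈ M₊(ℝ₊)`, of
[cite: BergChristensenRessel1984, p. 141]: the atom `μ({0})` is the coefficient `a`).
Not to be confused with Mathlib's `StieltjesFunction` (monotone right-continuous functions). -/
def IsStieltjesFunction (f : ℝ → ℝ) : Prop :=
  ∃ (a b : ℝ) (σ : Measure ℝ), 0 ≤ a ∧ 0 ≤ b ∧ σ (Iic 0) = 0 ∧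
    Integrable (fun t : ℝ => (1 + t)⁻¹) σ ∧
    ∀ s : ℝ, 0 < s → f s = a / s + b + ∫ t, (s + t)⁻¹ ∂σ

namespace IsStieltjesFunction

/-! ### The Stieltjes kernel `(s + t)⁻¹` against an admissible measure -/

/-- A measure carried by `(0, ∞)` sees only positive points. [folklore] -/
theorem ae_pos_of_measure_Iic {σ : Measure ℝ} (hσ : σ (Iic 0) = 0) : ∀ᵐ t ∂σ, 0 < t := by
  have h : ∀ᵐ t ∂σ, t ∉ Iic (0 : ℝ) := measure_eq_zero_iff_ae_notMem.1 hσ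
  filter_upwards [h] with t ht
  simpa using ht

/-- Pointwise comparison of the Stieltjes kernel with `(1 + t)⁻¹`: for `s, t > 0`,
`(s + t)⁻¹ ≤ max 1 s⁻¹ · (1 + t)⁻¹`. [folklore] -/
theorem inv_add_le_max_mul {s t : ℝ} (hs : 0 < s) (ht : 0 < t) :
    (s + t)⁻¹ ≤ max 1 s⁻¹ * (1 + t)⁻¹ := by
  have hst : 0 < s + t := by positivity
  have h1t : 0 < 1 + t := by positivity
  rw [← div_eq_mul_inv, le_div_iff₀ h1t, inv_mul_le_iff₀ hst]
  have hcs : 1 ≤ max 1 s⁻¹ * s := by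
    calc (1 : ℝ) = s⁻¹ * s := (inv_mul_cancel₀ hs.ne').symm
      _ ≤ max 1 s⁻¹ * s := by gcongr; exact le_max_right _ _
  have hct : t ≤ max 1 s⁻¹ * t := le_mul_of_one_le_left ht.le (le_max_left _ _)
  nlinarith

/-- For a measure `σ` carried by `(0,∞)` with `∫ (1+t)⁻¹ dσ < ∞`, the Stieltjes kernel
`t ↦ (s + t)⁻¹` is `σ`-integrable for every `s > 0`. [folklore] -/
theorem integrable_inv_add {σ : Measure ℝ} (hσ : σ (Iic 0) = 0)
    (hint : Integrable (fun t : ℝ => (1 + t)⁻¹) σ) {s : ℝ} (hs : 0 < s) :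
    Integrable (fun t : ℝ => (s + t)⁻¹) σ := by
  refine (hint.const_mul (max 1 s⁻¹)).mono'
    ((measurable_const.add measurable_id).inv.aestronglyMeasurable) ?_
  filter_upwards [ae_pos_of_measure_Iic hσ] with t ht
  have hst : 0 < s + t := by positivity
  rw [Real.norm_eq_abs, abs_of_pos (inv_pos.2 hst)]
  exact inv_add_le_max_mul hs ht

/-- The Stieltjes integral `∫ (s + t)⁻¹ dσ(t)` is non-negative (`σ` carried by `(0,∞)`, `s > 0`).
[folklore] -/
theorem integral_inv_add_nonneg {σ : Measure ℝ} (hσ : σ (Iic 0) = 0) {s : ℝ} (hs : 0 < s) :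
    0 ≤ ∫ t, (s + t)⁻¹ ∂σ := by
  refine integral_nonneg_of_ae ?_
  filter_upwards [ae_pos_of_measure_Iic hσ] with t ht
  exact inv_nonneg.2 (by positivity)

/-- The Stieltjes integral is non-increasing in `s > 0`. [folklore] -/
theorem integral_inv_add_antitone {σ : Measure ℝ} (hσ : σ (Iic 0) = 0)
    (hint : Integrable (fun t : ℝ => (1 + t)⁻¹) σ) {s s' : ℝ} (hs : 0 < s) (hss' : s ≤ s') :
    ∫ t, (s' + t)⁻¹ ∂σ ≤ ∫ t, (s + t)⁻¹ ∂σ := by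
  refine integral_mono_ae (integrable_inv_add hσ hint (hs.trans_le hss'))
    (integrable_inv_add hσ hint hs) ?_
  filter_upwards [ae_pos_of_measure_Iic hσ] with t ht
  have hst : 0 < s + t := by positivity
  exact inv_anti₀ hst (by linarith)

/-! ### Elementary consequences of the representation -/

variable {f g : ℝ → ℝ}

/-- A Stieltjes function is non-negative on `(0, ∞)`. [cite: SchillingSongVondracek2012, Def. 2.1] -/
theorem nonneg (hf : IsStieltjesFunction f) {s : ℝ} (hs : 0 < s) : 0 ≤ f s := by
  obtain ⟨a, b, σ, ha, hb, hσ, -, hrep⟩ := hf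
  rw [hrep s hs]
  have : 0 ≤ a / s := div_nonneg ha hs.le
  have := integral_inv_add_nonneg hσ hs (σ := σ)
  positivity

/-- A Stieltjes function is non-increasing on `(0, ∞)`. [folklore] -/
theorem antitoneOn (hf : IsStieltjesFunction f) : AntitoneOn f (Ioi 0) := by
  obtain ⟨a, b, σ, ha, hb, hσ, hint, hrep⟩ := hf
  intro s hs s' hs' hss'
  rw [hrep s hs, hrep s' hs']
  have h1 : a / s' ≤ a / s := div_le_div_of_nonneg_left ha hs hss'
  have h2 := integral_inv_add_antitone hσ hint hs hss'
  linarith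

/-- Only the values on `(0, ∞)` matter. [folklore] -/
theorem congr (hf : IsStieltjesFunction f) (hfg : EqOn f g (Ioi 0)) : IsStieltjesFunction g := by
  obtain ⟨a, b, σ, ha, hb, hσ, hint, hrep⟩ := hf
  exact ⟨a, b, σ, ha, hb, hσ, hint, fun s hs => (hfg hs).symm.trans (hrep s hs)⟩

/-! ### The convex cone structure -/

/-- Stieltjes functions form a convex cone: closure under addition.
[cite: SchillingSongVondracek2012, Ch. 2] -/
theorem add (hf : IsStieltjesFunction f) (hg : IsStieltjesFunction g) :
    IsStieltjesFunction (f + g) := by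
  obtain ⟨a, b, σ, ha, hb, hσ, hint, hrep⟩ := hf
  obtain ⟨a', b', σ', ha', hb', hσ', hint', hrep'⟩ := hg
  refine ⟨a + a', b + b', σ + σ', add_nonneg ha ha', add_nonneg hb hb', ?_,
    hint.add_measure hint', fun s hs => ?_⟩
  · simp [Measure.add_apply, hσ, hσ']
  · rw [Pi.add_apply, hrep s hs, hrep' s hs,
      integral_add_measure (integrable_inv_add hσ hint hs) (integrable_inv_add hσ' hint' hs)]
    ring

/-- Stieltjes functions form a convex cone: closure under multiplication by `c ≥ 0`.
[cite: SchillingSongVondracek2012, Ch. 2] -/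
theorem smul (hf : IsStieltjesFunction f) {c : ℝ} (hc : 0 ≤ c) :
    IsStieltjesFunction (c • f) := by
  obtain ⟨a, b, σ, ha, hb, hσ, hint, hrep⟩ := hf
  refine ⟨c * a, c * b, (ENNReal.ofReal c) • σ, mul_nonneg hc ha, mul_nonneg hc hb, ?_,
    hint.smul_measure ENNReal.ofReal_ne_top, fun s hs => ?_⟩
  · simp [Measure.smul_apply, hσ]
  · rw [Pi.smul_apply, hrep s hs, integral_smul_measure, ENNReal.toReal_ofReal hc, smul_eq_mul,
      smul_eq_mul]
    ring

/-- Alias of `IsStieltjesFunction.smul` in `fun`-form. [folklore] -/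
theorem const_mul (hf : IsStieltjesFunction f) {c : ℝ} (hc : 0 ≤ c) :
    IsStieltjesFunction (fun s => c * f s) :=
  hf.smul hc

/-! ### Examples -/

/-- Non-negative constants are Stieltjes functions (`a = 0`, `σ = 0`).
[cite: SchillingSongVondracek2012, Def. 2.1] -/
theorem _root_.Literature.Analysis.SpecialFunctions.isStieltjesFunction_const {b : ℝ}
    (hb : 0 ≤ b) : IsStieltjesFunction (fun _ => b) :=
  ⟨0, b, 0, le_rfl, hb, by simp, by simp, fun s _ => by simp⟩

/-- `s ↦ 1 / s` is a Stieltjes function (`a = 1`, `b = 0`, `σ = 0`).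
[cite: BergChristensenRessel1984, p. 141] -/
theorem _root_.Literature.Analysis.SpecialFunctions.isStieltjesFunction_one_div :
    IsStieltjesFunction (fun s => 1 / s) :=
  ⟨1, 0, 0, zero_le_one, le_rfl, by simp, by simp, fun s _ => by simp⟩

/-- `s ↦ s⁻¹` is a Stieltjes function. [cite: BergChristensenRessel1984, p. 141] -/
theorem _root_.Literature.Analysis.SpecialFunctions.isStieltjesFunction_inv :
    IsStieltjesFunction (fun s => s⁻¹) :=
  isStieltjesFunction_one_div.congr fun s _ => (one_div s)

/-- For `m > 0`, the resolvent-type function `s ↦ (s + m)⁻¹` is a Stieltjes function, with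
representing measure the unit mass at `m` (`a = b = 0`, `σ = δₘ`).
[cite: BergChristensenRessel1984, p. 141] -/
theorem _root_.Literature.Analysis.SpecialFunctions.isStieltjesFunction_inv_add_const_of_pos
    {m : ℝ} (hm : 0 < m) : IsStieltjesFunction (fun s => (s + m)⁻¹) := by
  refine ⟨0, 0, Measure.dirac m, le_rfl, le_rfl, ?_, ?_, fun s _ => ?_⟩
  · rw [Measure.dirac_apply' _ measurableSet_Iic, Set.indicator_of_notMem (by simpa using hm)]
  · exact (integrable_const ((1 + m)⁻¹)).congr (ae_eq_dirac fun t : ℝ => (1 + t)⁻¹).symm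
  · simp [integral_dirac]

/-- For `m ≥ 0`, `s ↦ (s + m)⁻¹` is a Stieltjes function (`m = 0` being `s⁻¹`).
[cite: BergChristensenRessel1984, p. 141] -/
theorem _root_.Literature.Analysis.SpecialFunctions.isStieltjesFunction_inv_add_const {m : ℝ}
    (hm : 0 ≤ m) : IsStieltjesFunction (fun s => (s + m)⁻¹) := by
  rcases hm.lt_or_eq with hm | rfl
  · exact isStieltjesFunction_inv_add_const_of_pos hm
  · exact isStieltjesFunction_inv.congr fun s _ => by simp

/-! ### Power functions `s ↦ s^{-α}`, `0 < α ≤ 1` -/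

/-- Integrability of `u ↦ u^{-α} (1+u)⁻¹` on `(0, ∞)` for `0 < α < 1` (the density of the Stieltjes
measure of `s^{-α}` against its own kernel at `s = 1`). [folklore] -/
theorem integrableOn_rpow_neg_mul_inv_one_add {α : ℝ} (h0 : 0 < α) (h1 : α < 1) :
    IntegrableOn (fun u : ℝ => u ^ (-α) * (1 + u)⁻¹) (Ioi 0) := by
  have hmeas : Measurable fun u : ℝ => u ^ (-α) * (1 + u)⁻¹ := by fun_prop
  rw [← Ioc_union_Ioi_eq_Ioi zero_le_one]
  refine IntegrableOn.union ?_ ?_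
  · -- on `(0, 1]` dominate by `u^{-α}`, integrable since `-α > -1`
    have hg : IntegrableOn (fun u : ℝ => u ^ (-α)) (Ioc 0 1) :=
      (intervalIntegrable_iff_integrableOn_Ioc_of_le zero_le_one).1
        (intervalIntegral.intervalIntegrable_rpow' (by linarith))
    refine hg.mono' hmeas.aestronglyMeasurable (ae_restrict_of_forall_mem measurableSet_Ioc ?_)
    rintro u ⟨hu0, hu1⟩
    have hpow : 0 ≤ u ^ (-α) := Real.rpow_nonneg hu0.le _
    have hinv : (1 + u)⁻¹ ≤ 1 := inv_le_one_of_one_le₀ (by linarith)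
    have hinv0 : 0 ≤ (1 + u)⁻¹ := inv_nonneg.2 (by linarith)
    rw [Real.norm_eq_abs, abs_of_nonneg (mul_nonneg hpow hinv0)]
    exact mul_le_of_le_one_right hpow hinv
  · -- on `(1, ∞)` dominate by `u^{-α-1}`, integrable since `-α-1 < -1`
    have hg : IntegrableOn (fun u : ℝ => u ^ (-α - 1)) (Ioi 1) :=
      integrableOn_Ioi_rpow_of_lt (by linarith) zero_lt_one
    refine hg.mono' hmeas.aestronglyMeasurable (ae_restrict_of_forall_mem measurableSet_Ioi ?_)
    intro u (hu1 : 1 < u)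
    have hu0 : 0 < u := zero_lt_one.trans hu1
    have hpow : 0 ≤ u ^ (-α) := Real.rpow_nonneg hu0.le _
    have hinv0 : 0 ≤ (1 + u)⁻¹ := inv_nonneg.2 (by linarith)
    have hinv : (1 + u)⁻¹ ≤ u⁻¹ := inv_anti₀ hu0 (by linarith)
    rw [Real.norm_eq_abs, abs_of_nonneg (mul_nonneg hpow hinv0), Real.rpow_sub_one hu0.ne',
      div_eq_mul_inv]
    exact mul_le_mul_of_nonneg_left hinv hpow

/-- Positivity of the normalising constant `∫₀^∞ u^{-α} (1+u)⁻¹ du` (`= π / sin (πα)`, a value not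
needed here). [folklore] -/
theorem integral_rpow_neg_mul_inv_one_add_pos {α : ℝ} (h0 : 0 < α) (h1 : α < 1) :
    0 < ∫ u in Ioi (0 : ℝ), u ^ (-α) * (1 + u)⁻¹ := by
  have hpos : ∀ u ∈ Ioi (0 : ℝ), 0 < u ^ (-α) * (1 + u)⁻¹ := fun u (hu : 0 < u) =>
    mul_pos (Real.rpow_pos_of_pos hu _) (inv_pos.2 (by linarith))
  rw [setIntegral_pos_iff_support_of_nonneg_ae
    (ae_restrict_of_forall_mem measurableSet_Ioi fun u hu => (hpos u hu).le)
    (integrableOn_rpow_neg_mul_inv_one_add h0 h1)]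
  refine lt_of_lt_of_le (by simp) (measure_mono fun u hu => ⟨(hpos u hu).ne', hu⟩)

/-- Scaling of the Stieltjes kernel against `u^{-α} du`: for `s > 0`,
`∫₀^∞ t^{-α} (s+t)⁻¹ dt = s^{-α} ∫₀^∞ u^{-α} (1+u)⁻¹ du` (substitute `t = s u`). [folklore] -/
theorem integral_rpow_neg_mul_inv_add {α : ℝ} {s : ℝ} (hs : 0 < s) :
    ∫ t in Ioi (0 : ℝ), t ^ (-α) * (s + t)⁻¹ =
      s ^ (-α) * ∫ u in Ioi (0 : ℝ), u ^ (-α) * (1 + u)⁻¹ := by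
  have h := integral_comp_mul_left_Ioi (fun t : ℝ => t ^ (-α) * (s + t)⁻¹) 0 hs
  rw [mul_zero, smul_eq_mul] at h
  have hL : ∫ u in Ioi (0 : ℝ), (fun t : ℝ => t ^ (-α) * (s + t)⁻¹) (s * u) =
      s⁻¹ * (s ^ (-α) * ∫ u in Ioi (0 : ℝ), u ^ (-α) * (1 + u)⁻¹) := by
    rw [← integral_const_mul, ← integral_const_mul]
    refine setIntegral_congr_fun measurableSet_Ioi fun u (hu : 0 < u) => ?_
    simp only
    rw [Real.mul_rpow hs.le hu.le, show s + s * u = s * (1 + u) by ring, mul_inv]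
    ring
  rw [hL] at h
  exact (mul_left_cancel₀ (inv_ne_zero hs.ne') h).symm

/-- `s ↦ s^{-α}` is a Stieltjes function for `0 < α < 1`, with `a = b = 0` and representing measure
`σ(dt) = C(α)⁻¹ t^{-α} dt` on `(0,∞)`, `C(α) = ∫₀^∞ u^{-α}(1+u)⁻¹ du` (`= π / sin (πα)`).
[cite: BergChristensenRessel1984, p. 141] -/
theorem _root_.Literature.Analysis.SpecialFunctions.isStieltjesFunction_rpow_neg_of_lt_one {α : ℝ}
    (h0 : 0 < α) (h1 : α < 1) : IsStieltjesFunction (fun s => s ^ (-α)) := by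
  set C : ℝ := ∫ u in Ioi (0 : ℝ), u ^ (-α) * (1 + u)⁻¹ with hC
  have hCpos : 0 < C := integral_rpow_neg_mul_inv_one_add_pos h0 h1
  -- the density `w = C⁻¹ u^{-α}` as an `ℝ≥0`-valued function, and the measure `σ = w · Leb|(0,∞)`
  set w : ℝ → ℝ≥0 := fun u => Real.toNNReal (C⁻¹ * u ^ (-α)) with hw
  have hwm : Measurable w := by
    simp only [hw]
    fun_prop
  have hw_coe : ∀ u : ℝ, 0 < u → (w u : ℝ) = C⁻¹ * u ^ (-α) := fun u hu =>
    Real.coe_toNNReal _ (mul_nonneg (inv_nonneg.2 hCpos.le) (Real.rpow_nonneg hu.le _))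
  set μ : Measure ℝ := volume.restrict (Ioi 0) with hμ
  refine ⟨0, 0, μ.withDensity fun u => w u, le_rfl, le_rfl, ?_, ?_, fun s hs => ?_⟩
  · -- carried by `(0, ∞)`
    refine withDensity_absolutelyContinuous _ _ ?_
    rw [hμ, Measure.restrict_apply measurableSet_Iic, Iic_inter_Ioi, Ioc_self, measure_empty]
  · -- `∫ (1+t)⁻¹ dσ < ∞`
    rw [integrable_withDensity_iff_integrable_smul hwm]
    refine ((integrableOn_rpow_neg_mul_inv_one_add h0 h1).const_mul C⁻¹).congr ?_
    refine ae_restrict_of_forall_mem measurableSet_Ioi fun u (hu : 0 < u) => ?_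
    show C⁻¹ * (u ^ (-α) * (1 + u)⁻¹) = w u • (1 + u)⁻¹
    rw [NNReal.smul_def, smul_eq_mul, hw_coe u hu, mul_assoc]
  · -- the representation
    simp only [zero_div, zero_add]
    rw [integral_withDensity_eq_integral_smul hwm]
    have : ∫ u, w u • (s + u)⁻¹ ∂μ = ∫ u in Ioi (0 : ℝ), C⁻¹ * (u ^ (-α) * (s + u)⁻¹) :=
      setIntegral_congr_fun measurableSet_Ioi fun u (hu : 0 < u) => by
        rw [NNReal.smul_def, smul_eq_mul, hw_coe u hu, mul_assoc]
    rw [this, integral_const_mul, integral_rpow_neg_mul_inv_add hs, ← hC]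
    field_simp

/-- `s ↦ s^{-α}` is a Stieltjes function for `0 < α ≤ 1` (`α = 1` being `1/s`).
[cite: BergChristensenRessel1984, p. 141] -/
theorem _root_.Literature.Analysis.SpecialFunctions.isStieltjesFunction_rpow_neg {α : ℝ}
    (h0 : 0 < α) (h1 : α ≤ 1) : IsStieltjesFunction (fun s => s ^ (-α)) := by
  rcases h1.lt_or_eq with h1 | rfl
  · exact isStieltjesFunction_rpow_neg_of_lt_one h0 h1
  · exact isStieltjesFunction_inv.congr fun s _ => (Real.rpow_neg_one s).symm

/-! ### Translates `s ↦ f (s + m)` and the example `s ↦ (1 + s)^{-α}` -/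

/-- The Stieltjes cone is invariant under right translation of the argument: if `f` is a Stieltjes
function and `m ≥ 0` then so is `s ↦ f (s + m)` (the atom `a/s` becomes `a/(s+m) = a ∫ dδₘ(t)/(s+t)`,
the measure `σ` is pushed forward under `t ↦ t + m`). [folklore] -/
theorem comp_add_right (hf : IsStieltjesFunction f) {m : ℝ} (hm : 0 ≤ m) :
    IsStieltjesFunction (fun s => f (s + m)) := by
  obtain ⟨a, b, σ, ha, hb, hσ, hint, hrep⟩ := hf
  have hemb : MeasurableEmbedding (fun t : ℝ => t + m) :=
    (Homeomorph.addRight m).measurableEmbedding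
  set σ' : Measure ℝ := σ.map (fun t : ℝ => t + m) with hσ'
  have hσ'0 : σ' (Iic 0) = 0 := by
    rw [hσ', hemb.map_apply]
    refine measure_mono_null (fun t (ht : t + m ≤ 0) => ?_) hσ
    show t ≤ 0
    linarith
  have hint' : Integrable (fun t : ℝ => (1 + t)⁻¹) σ' := by
    rw [hσ', hemb.integrable_map_iff]
    refine hint.mono' ?_ ?_
    · exact (Measurable.inv
        (measurable_const.add (measurable_id.add measurable_const))).aestronglyMeasurable
    · filter_upwards [ae_pos_of_measure_Iic hσ] with t ht
      simp only [Function.comp_apply]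
      rw [Real.norm_eq_abs, abs_of_pos (by positivity)]
      exact inv_anti₀ (by positivity) (by linarith)
  have hrepr : ∀ s : ℝ, ∫ t, (s + t)⁻¹ ∂σ' = ∫ t, (s + m + t)⁻¹ ∂σ := by
    intro s
    rw [hσ', hemb.integral_map]
    refine integral_congr_ae (Eventually.of_forall fun t => ?_)
    simp only [add_assoc, add_comm m t]
  have h1 : IsStieltjesFunction (fun s => a * (s + m)⁻¹) :=
    (isStieltjesFunction_inv_add_const hm).const_mul ha
  have h2 : IsStieltjesFunction (fun _ => b) := isStieltjesFunction_const hb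
  have h3 : IsStieltjesFunction (fun s => ∫ t, (s + t)⁻¹ ∂σ') :=
    ⟨0, 0, σ', le_rfl, le_rfl, hσ'0, hint', fun s _ => by simp⟩
  refine ((h1.add h2).add h3).congr fun s (hs : 0 < s) => ?_
  simp only [Pi.add_apply]
  rw [hrep (s + m) (by linarith), hrepr s, div_eq_mul_inv]

/-- `s ↦ (1 + s)^{-α}` is a Stieltjes function for `0 < α ≤ 1` (translate of `s^{-α}`; its measure is
`C(α)⁻¹ (t-1)^{-α} dt` on `(1, ∞)` for `α < 1`, `δ₁` for `α = 1`).
[cite: BergChristensenRessel1984, p. 141] -/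
theorem _root_.Literature.Analysis.SpecialFunctions.isStieltjesFunction_one_add_rpow_neg {α : ℝ}
    (h0 : 0 < α) (h1 : α ≤ 1) : IsStieltjesFunction (fun s => (1 + s) ^ (-α)) :=
  ((isStieltjesFunction_rpow_neg h0 h1).comp_add_right zero_le_one).congr fun s _ => by
    simp only [add_comm s 1]

end IsStieltjesFunction

end Literature.Analysis.SpecialFunctions
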